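import Summits.KontsevichZagierPeriods.Zeta5Search.Barrier.ConeGammaHeadHarmonic
import Summits.KontsevichZagierPeriods.Zeta5Search.Barrier.ConeGammaLogCuspPeriods

/-!
# ζ(5) search — BARRIER: S-E's signed shape from translate dominance, at the DESK NOTE's σ-scale constants

HONEST FRAMING (cell `pub-zeta5`): systematic search; no irrationality claim unless kernel-certified. MODEL objects
under Brown–Zudilin's (28)+(30) accounting ([BZ22] = arXiv:2210.03391; (28) observed, not proved); nothing here is a
statement about `ζ(5)`, about `γ`, or about the cone's supremum (C2 = `BarrierC2` OPEN). The lemma S-E WITH USEFUL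
CONSTANTS stays CONJECTURED: the constants below are the desk note's NO-CANCELLATION constants (lead/lit g27
`SE-DESK-NOTE.md` §2–3), which by the note's own §3(ii) are still 3–20× over the `BARRIER-PLAN.md` §2b plausibility
budget at covering level `λ₀ = 60` for generic transversal directions (inside budget only for axis directions at
`λ₀ ≈ 480`); so this file SHARPENS WHAT a static translate-dominance certificate at a lattice point would buy — it is
NOT a usable bound, and translate dominance is proved here for NO direction. No number of record moves; records in
print UNMOVED. Prover P2 g20 (self-selected Lean-only item of the P2 lineage; re-proof of P2 g19's
`ConeGammaTranslateDominance.phi30_sub_le_of_translateDominance` with the two first-moment inputs replaced by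
`ConeGammaCrossings.setIntegral_abs_torusN_sub_le_period` and the head by
`ConeGammaHeadHarmonic.abs_head_integral_le_harmonic`).

With `Δ_ε(u) := 𝒩(u·s(a) + (uε)·δ) − 𝒩(u·s(a))`, `P(·) = translateIntegral a T ·`, `Y = shiftSize δ`,
`σ₁ := Σ_k |φ_k(δ)|` (written out; the desk note's `σ(v) ∈ [7, 49]` for a sup-norm-1 transversal `v`):

* **`abs_period_integral_sub_translate_le_sharp`** — for `k ≥ 1` and EVERY `ε ≥ 0` (no smallness needed):
  `|∫_{kT}^{(k+1)T} Δ_ε u⁻² − (P(εkT·δ) − P(0))/(kT)²| ≤ εT·(T·σ₁)/(kT)² + εkT·(T·σ₁)·((kT)⁻² − ((k+1)T)⁻²)`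
  (P2 g19's `abs_period_integral_sub_translate_le` with `C₁ = 392·Y·(T·x_max + 5)/x_min` replaced by `T·σ₁`:
  drift `‖A_k‖₁ ≤ εT²σ₁`, translate `‖B_k‖₁ ≤ εkT²σ₁` — the desk note's `λ₀·ελ₀σ(v)` and `εkλ₀²σ(v)`).
* **`phi30_sub_le_of_translateDominance_sharp`** — SAME hypotheses and range as p422589's theorem: for `a` in the
  closed box with all 28 forms positive, a period `T`, a displacement `δ`, constants `A ≥ 0`, `ρ_A > 0` and the
  HYPOTHESIS «`P(η·δ) − P(0) ≤ T·A·η` for `0 < η ≤ ρ_A`» (translate dominance along the ray — proved for NO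
  direction), for every `0 < ε ≤ min(ρ′/(2T), 1/(T·Y+1), x_min/(2Y+1))` (`ρ′ = min(ρ_A, 1/(Y+1))`) with the
  perturbed direction in the box:
  **`Φ(aOfS(s(a)+εδ)) − Φ(a) ≤ A·ε·log(1/ε) + ε·[A·(1 + |log(ρ′/T)|) + σ₁·(1 + log(T·x_max + 1)) + 4·σ₁ + 14/ρ′]`**
  — the desk note's §3(i) «`A·ε ln(1/(λ₀ε)) + ε·[A(3 + ln ρ) + σ(v)(5.93 + ln 2λ₀)]`» at the same scale
  (head `(1 + log(T·x_max+1))·σ₁`, periods `4σ₁` by the telescoping `period_error_le`, tail `14/ρ′`).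
NOT here (honest): translate dominance at any direction, the within-period first-moment CANCELLATION (these are
no-cancellation bounds), anything about `γ`, C2 or `ζ(5)`.
-/

noncomputable section

open Set MeasureTheory
open scoped Topology

namespace Summit.KontsevichZagierPeriods.Zeta5Search.Barrier.ConeGamma

/-! ### One period `[kT, (k+1)T]`, `k ≥ 1`, at the desk note's scale -/

/-- **Period `k ≥ 1`, desk-note scale.** With `Δ_ε(u) = 𝒩(u·s(a) + (uε)·δ) − 𝒩(u·s(a))`, `δ_k = (εkT)·δ` and
`σ₁ = Σ_i |φ_i(δ)|`:
`|∫_{kT}^{(k+1)T} Δ_ε(u) u⁻² du − (P(δ_k) − P(0))/(kT)²| ≤ εT·(T·σ₁)/(kT)² + εkT·(T·σ₁)·((kT)⁻² − ((k+1)T)⁻²)`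
for EVERY `ε ≥ 0` (periodicity `u = kT + s`; drift and weight freezing by `setIntegral_abs_torusN_sub_le_period`). -/
theorem abs_period_integral_sub_translate_le_sharp {a : Dir} (hpos : ∀ k, 0 < h28 a k) {T : ℝ} (hT : 0 < T)
    (hper : ∀ k : Fin 28, ∃ z : ℤ, T * h28 a k = z) (δ : Fin 8 → ℝ) {ε : ℝ} (hε : 0 ≤ ε) {k : ℕ} (hk : 1 ≤ k) :
    |(∫ u in ((k : ℝ) * T)..(((k : ℝ) + 1) * T),
        ((torusN (u • sParam a + (u * ε) • δ) : ℝ) - torusN (u • sParam a)) / u ^ 2)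
      - (translateIntegral a T ((ε * (k * T)) • δ) - translateIntegral a T 0) / ((k : ℝ) * T) ^ 2|
      ≤ (1 / ((k : ℝ) * T) ^ 2) * ((ε * T) * (T * ∑ i, |phiForm δ i|))
        + (1 / ((k : ℝ) * T) ^ 2 - 1 / (((k : ℝ) + 1) * T) ^ 2)
          * ((ε * (k * T)) * (T * ∑ i, |phiForm δ i|)) := by
  have hk1 : (1 : ℝ) ≤ k := by exact_mod_cast hk
  have hk0 : (0 : ℝ) < k * T := mul_pos (by linarith) hT
  set c : Fin 8 → ℝ := (ε * (k * T)) • δ with hc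
  -- the three players on `[0, T]`
  set A : ℝ → ℝ := fun s => (torusN (s • sParam a + c + (s * ε) • δ) : ℝ) - torusN (s • sParam a + c)
    with hA
  set B : ℝ → ℝ := fun s => (torusN (s • sParam a + c) : ℝ) - torusN (s • sParam a) with hB
  set w : ℝ → ℝ := fun s => 1 / (s + k * T) ^ 2 with hw
  -- Step 1: substitution `u = s + kT` and periodicity
  have hsub : (∫ u in ((k : ℝ) * T)..(((k : ℝ) + 1) * T),
        ((torusN (u • sParam a + (u * ε) • δ) : ℝ) - torusN (u • sParam a)) / u ^ 2)
      = ∫ s in (0 : ℝ)..T, (A s + B s) * w s := by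
    have h := intervalIntegral.integral_comp_add_right (a := 0) (b := T)
      (fun u : ℝ => ((torusN (u • sParam a + (u * ε) • δ) : ℝ) - torusN (u • sParam a)) / u ^ 2)
      ((k : ℝ) * T)
    rw [zero_add, show T + (k : ℝ) * T = ((k : ℝ) + 1) * T by ring] at h
    rw [← h]
    refine intervalIntegral.integral_congr fun s _ => ?_
    have h1 : torusN ((s + k * T) • sParam a + ((s + k * T) * ε) • δ)
        = torusN (s • sParam a + c + (s * ε) • δ) := by
      rw [torusN_line_add_nat_mul_period hper, hc, show (s + k * T) * ε = ε * (k * T) + s * ε by ring,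
        add_smul, add_assoc]
    have h2 : torusN ((s + k * T) • sParam a) = torusN (s • sParam a) := by
      have := torusN_line_add_nat_mul_period hper 0 s k
      simpa using this
    simp only [hA, hB, hw, h1, h2]
    ring
  -- Step 2: the data of the weight-freezing lemma
  have hAint : IntervalIntegrable A volume 0 T :=
    (intervalIntegrable_torusN_driftLine a δ c ε 0 T).sub (intervalIntegrable_torusN_line a c 0 T)
  have hBint : IntervalIntegrable B volume 0 T := intervalIntegrable_shiftDiff a δ (ε * (k * T)) 0 T
  have hwcont : ContinuousOn w (uIcc 0 T) := by
    refine continuousOn_const.div (by fun_prop) fun s hs => ?_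
    rw [uIcc_of_le hT.le] at hs
    have : 0 < s + k * T := by linarith [hs.1]
    positivity
  have hw1 : ∀ s ∈ Ioc 0 T, |w s| ≤ 1 / ((k : ℝ) * T) ^ 2 := by
    intro s hs
    have hspos : 0 < s + k * T := by linarith [hs.1]
    rw [hw, abs_of_pos (by positivity)]
    exact one_div_le_one_div_of_le (by positivity) (by nlinarith [hs.1])
  have hw2 : ∀ s ∈ Ioc 0 T, |w s - 1 / ((k : ℝ) * T) ^ 2|
      ≤ 1 / ((k : ℝ) * T) ^ 2 - 1 / (((k : ℝ) + 1) * T) ^ 2 := by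
    intro s hs
    have hspos : 0 < s + k * T := by linarith [hs.1]
    have hle1 : w s ≤ 1 / ((k : ℝ) * T) ^ 2 :=
      one_div_le_one_div_of_le (by positivity) (by nlinarith [hs.1])
    have hle2 : 1 / (((k : ℝ) + 1) * T) ^ 2 ≤ w s :=
      one_div_le_one_div_of_le (by positivity) (by nlinarith [hs.2, hT])
    rw [abs_sub_comm, abs_of_nonneg (by linarith)]
    linarith
  have hw₀ : (0 : ℝ) ≤ 1 / ((k : ℝ) * T) ^ 2 := by positivity
  have hd : (0 : ℝ) ≤ 1 / ((k : ℝ) * T) ^ 2 - 1 / (((k : ℝ) + 1) * T) ^ 2 := by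
    have : 1 / (((k : ℝ) + 1) * T) ^ 2 ≤ 1 / ((k : ℝ) * T) ^ 2 :=
      one_div_le_one_div_of_le (by positivity) (by nlinarith [hT])
    linarith
  -- Step 3: the two first-moment bounds, at the desk note's scale
  have hAi : ∫ s in Ioc 0 T, |A s| ≤ (ε * T) * (T * ∑ i, |phiForm δ i|) := by
    refine (setIntegral_abs_torusN_drift_le_period hpos hT.le hper c δ hε).trans (le_of_eq ?_)
    ring
  have hBi : ∫ s in Ioc 0 T, |B s| ≤ (ε * (k * T)) * (T * ∑ i, |phiForm δ i|) := by
    refine (setIntegral_abs_torusN_translate_le_period hpos hT.le hper δ (η := ε * (k * T))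
      (by positivity)).trans (le_of_eq ?_)
    ring
  -- Step 4: assemble
  have hPB : ∫ s in (0 : ℝ)..T, B s = translateIntegral a T ((ε * (k * T)) • δ) - translateIntegral a T 0 :=
    (translateIntegral_sub_eq a T δ (ε * (k * T))).symm
  have key := abs_integral_add_mul_sub_le hT.le hAint hBint hwcont hw₀ hd hw1 hw2 hAi hBi
  rw [hPB] at key
  rw [hsub, div_eq_mul_one_div (translateIntegral a T _ - _), mul_comm (translateIntegral a T _ - _)]
  exact key

/-! ### The bound at the desk note's scale -/

/-- **S-E's signed shape from translate dominance along a ray, at the desk note's σ-scale** (lead/lit g27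
`SE-DESK-NOTE.md` §3(i); re-proof of P2 g19's `phi30_sub_le_of_translateDominance` with the constants of
`ConeGammaCrossings` / `ConeGammaHeadHarmonic`). Same hypotheses and range; `ρ′ = min ρ_A (1/(Y+1))`,
`σ₁ = Σ_i |φ_i(δ)|`; conclusion
`Φ(a_ε) − Φ(a) ≤ A·ε·log(1/ε) + ε·[A·(1 + |log(ρ′/T)|) + σ₁·(1 + log(T·x_max + 1)) + 4·σ₁ + 14/ρ′]`. -/
theorem phi30_sub_le_of_translateDominance_sharp {a : Dir} (ha : BZBox a) (hpos : ∀ k, 0 < h28 a k) {T : ℝ}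
    (hT : 0 < T) (hper : ∀ k : Fin 28, ∃ z : ℤ, T * h28 a k = z) (δ : Fin 8 → ℝ) {A ρA : ℝ} (hA : 0 ≤ A)
    (hρA : 0 < ρA)
    (hTD : ∀ η, 0 < η → η ≤ ρA → translateIntegral a T (η • δ) - translateIntegral a T 0 ≤ T * A * η)
    {ε : ℝ} (hε : 0 < ε)
    (hεle : ε ≤ min (min ρA (1 / (shiftSize δ + 1)) / (2 * T))
      (min (1 / (T * shiftSize δ + 1)) (xMin a / (2 * shiftSize δ + 1))))
    (haε : BZBox (aOfS (sParam a + ε • δ))) :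
    phi30 (aOfS (sParam a + ε • δ)) - phi30 a
      ≤ A * ε * Real.log (1 / ε)
        + ε * (A * (1 + |Real.log (min ρA (1 / (shiftSize δ + 1)) / T)|)
          + (∑ i, |phiForm δ i|) * (1 + Real.log (T * xMax a + 1))
          + 4 * ∑ i, |phiForm δ i|
          + 14 / min ρA (1 / (shiftSize δ + 1))) := by
  -- constants (opaque names with defining equations)
  have hY0 : 0 ≤ shiftSize δ := shiftSize_nonneg δ
  have hxm := xMin_pos hpos
  have hxM := xMax_pos hpos
  obtain ⟨S, hS⟩ : ∃ S : ℝ, S = ∑ i, |phiForm δ i| := ⟨_, rfl⟩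
  have hSnn : 0 ≤ S := by rw [hS]; exact Finset.sum_nonneg fun i _ => abs_nonneg _
  obtain ⟨C₁, hC₁⟩ : ∃ C₁ : ℝ, C₁ = T * S := ⟨_, rfl⟩
  have hC₁nn : 0 ≤ C₁ := by rw [hC₁]; exact mul_nonneg hT.le hSnn
  obtain ⟨ρ, hρdef⟩ : ∃ ρ : ℝ, ρ = min ρA (1 / (shiftSize δ + 1)) := ⟨_, rfl⟩
  have hρ : 0 < ρ := by rw [hρdef]; exact lt_min hρA (div_pos one_pos (by linarith))
  have hρA' : ρ ≤ ρA := by rw [hρdef]; exact min_le_left _ _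
  rw [← hρdef] at hεle
  rw [← hρdef, ← hS]
  -- the three smallness conditions on ε
  have hεa : ε * T ≤ ρ / 2 := by
    have : ε ≤ ρ / (2 * T) := hεle.trans (min_le_left _ _)
    rw [le_div_iff₀ (by linarith)] at this; linarith
  have hεb : ε * T * shiftSize δ ≤ 1 := by
    have h : ε ≤ 1 / (T * shiftSize δ + 1) := hεle.trans ((min_le_right _ _).trans (min_le_left _ _))
    rw [le_div_iff₀ (by nlinarith)] at h
    nlinarith [mul_nonneg hε.le hY0, mul_nonneg (mul_nonneg hε.le hT.le) hY0]
  have hεc : ε * shiftSize δ ≤ xMin a / 2 := by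
    have h : ε ≤ xMin a / (2 * shiftSize δ + 1) := hεle.trans ((min_le_right _ _).trans (min_le_right _ _))
    rw [le_div_iff₀ (by linarith)] at h
    nlinarith [mul_nonneg hε.le hY0]
  -- the number of periods below the dominance radius
  obtain ⟨K, hK⟩ : ∃ K : ℕ, K = ⌊ρ / (ε * T)⌋₊ := ⟨_, rfl⟩
  have hεT : 0 < ε * T := mul_pos hε hT
  have hx2 : (2 : ℝ) ≤ ρ / (ε * T) := by rw [le_div_iff₀ hεT]; linarith
  have hK2 : 2 ≤ K := by rw [hK]; exact Nat.le_floor (by exact_mod_cast hx2)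
  have hK2r : (2 : ℝ) ≤ K := by exact_mod_cast hK2
  have hKle : (K : ℝ) ≤ ρ / (ε * T) := by rw [hK]; exact Nat.floor_le (div_nonneg hρ.le hεT.le)
  have hKge : ρ / (ε * T) - 1 ≤ K := by
    have := Nat.lt_floor_add_one (ρ / (ε * T)); rw [← hK] at this; linarith
  have hKT : 0 < (K : ℝ) * T := mul_pos (by linarith) hT
  have hεKT : ε * (K * T) ≤ ρ := by
    have := mul_le_mul_of_nonneg_left hKle hεT.le
    rw [mul_div_cancel₀ _ hεT.ne'] at this; linarith
  -- the integrand in torus form and its integrability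
  obtain ⟨g, hg⟩ : ∃ g : ℝ → ℝ,
      g = fun u => ((torusN (u • sParam a + (u * ε) • δ) : ℝ) - torusN (u • sParam a)) / u ^ 2 := ⟨_, rfl⟩
  have hpert : ∀ u : ℝ, savingN (aOfS (sParam a + ε • δ)) u = torusN (u • sParam a + (u * ε) • δ) := by
    intro u; rw [savingN_eq_torusN_of_BZBox haε, sParam_aOfS, smul_add, smul_smul]
  have hF : phi30 (aOfS (sParam a + ε • δ)) - phi30 a = ∫ u in Ioi 0, g u := by
    unfold phi30
    rw [← integral_sub (integrableOn_savingN_div_sq haε) (integrableOn_savingN_div_sq ha)]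
    refine setIntegral_congr_fun measurableSet_Ioi fun u _ => ?_
    simp only [hg, hpert u, savingN_eq_torusN_of_BZBox ha, sub_div]
  have hgint : IntegrableOn g (Ioi 0) := by
    have h := (integrableOn_savingN_div_sq haε).sub (integrableOn_savingN_div_sq ha)
    refine h.congr_fun (fun u _ => ?_) measurableSet_Ioi
    simp only [hg, Pi.sub_apply, hpert u, savingN_eq_torusN_of_BZBox ha, sub_div]
  -- split `(0, ∞) = (0, KT] ∪ (KT, ∞)` and `(0, KT]` into periods
  have hsplit : ∫ u in Ioi 0, g u = (∫ u in (0 : ℝ)..(K * T), g u) + ∫ u in Ioi (K * T), g u := by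
    rw [← Ioc_union_Ioi_eq_Ioi hKT.le, setIntegral_union Ioc_disjoint_Ioi_same measurableSet_Ioi
      (hgint.mono_set Ioc_subset_Ioi_self) (hgint.mono_set (Ioi_subset_Ioi hKT.le)),
      intervalIntegral.integral_of_le hKT.le]
  have hperiods : ∫ u in (0 : ℝ)..(K * T), g u
      = ∑ k ∈ Finset.range K, ∫ u in ((k : ℝ) * T)..(((k : ℝ) + 1) * T), g u := by
    have h := intervalIntegral.sum_integral_adjacent_intervals (a := fun k : ℕ => (k : ℝ) * T) (n := K)
      (f := g) (μ := volume) fun k _ => ?_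
    · simp only [Nat.cast_zero, zero_mul] at h
      rw [← h]
      refine Finset.sum_congr rfl fun k _ => ?_
      push_cast; rfl
    · have hk0 : (0 : ℝ) ≤ k * T := mul_nonneg (Nat.cast_nonneg k) hT.le
      rw [intervalIntegrable_iff_integrableOn_Ioc_of_le (by push_cast; nlinarith)]
      exact hgint.mono_set fun u hu => lt_of_le_of_lt hk0 hu.1
  obtain ⟨K', hK'⟩ : ∃ K', K = K' + 1 := ⟨K - 1, by omega⟩
  have hsumsplit : ∑ k ∈ Finset.range K, (∫ u in ((k : ℝ) * T)..(((k : ℝ) + 1) * T), g u)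
      = (∑ j ∈ Finset.range K', ∫ u in (((j : ℝ) + 1) * T)..(((j : ℝ) + 1 + 1) * T), g u)
        + ∫ u in (0 : ℝ)..T, g u := by
    rw [hK', Finset.sum_range_succ']
    simp only [Nat.cast_add, Nat.cast_one, Nat.cast_zero, zero_mul, zero_add, one_mul]
  -- (i) the head, at harmonic scale
  have hhead : |∫ u in (0 : ℝ)..T, g u| ≤ ε * S * (1 + Real.log (T * xMax a + 1)) := by
    rw [hg, hS]
    exact abs_head_integral_le_harmonic hpos hT δ hε.le hεb hεc
  -- (ii) each period below the dominance radius: translate dominance + the two first-moment errors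
  have hP : ∀ j : ℕ, j < K' →
      (∫ u in (((j : ℝ) + 1) * T)..(((j : ℝ) + 1 + 1) * T), g u)
        ≤ A * ε * (1 / ((j : ℝ) + 1)) + (ε * C₁ / T) * (4 / (((j : ℝ) + 1) * ((j : ℝ) + 1 + 1))) := by
    intro j hj
    have hjK : (j : ℝ) + 1 ≤ K := by
      have hj' : (j : ℝ) + 1 ≤ K' := by exact_mod_cast hj
      rw [hK']; push_cast; linarith only [hj']
    have hj1 : ((j : ℝ) + 1) * T ≤ K * T := mul_le_mul_of_nonneg_right hjK hT.le
    have hj0 : (0 : ℝ) < (j : ℝ) + 1 := Nat.cast_add_one_pos j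
    have hρ'pos : 0 < ε * (((j : ℝ) + 1) * T) := mul_pos hε (mul_pos hj0 hT)
    have hρ'le : ε * (((j : ℝ) + 1) * T) ≤ ρ := (mul_le_mul_of_nonneg_left hj1 hε.le).trans hεKT
    have hper_k := abs_period_integral_sub_translate_le_sharp hpos hT hper δ hε.le (k := j + 1) (by omega)
    push_cast at hper_k
    rw [← hS, ← hC₁] at hper_k
    have hjnn : (0 : ℝ) ≤ (j : ℝ) := Nat.cast_nonneg j
    have herr := (abs_le.mp (hper_k.trans (period_error_le hε.le hT hC₁nn
      (by linarith only [hjnn])))).2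
    -- translate dominance at `η = ε (j+1) T ≤ ρ ≤ ρ_A`
    have hdom : (translateIntegral a T ((ε * (((j : ℝ) + 1) * T)) • δ) - translateIntegral a T 0)
        / (((j : ℝ) + 1) * T) ^ 2 ≤ A * ε * (1 / ((j : ℝ) + 1)) := by
      have h := hTD _ hρ'pos (hρ'le.trans hρA')
      have hpos2 : 0 < (((j : ℝ) + 1) * T) ^ 2 := by positivity
      calc _ ≤ T * A * (ε * (((j : ℝ) + 1) * T)) / (((j : ℝ) + 1) * T) ^ 2 :=
            div_le_div_of_nonneg_right h hpos2.le
        _ = A * ε * (1 / ((j : ℝ) + 1)) := by field_simp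
    rw [hg]
    linarith only [herr, hdom]
  -- (iii) the sum over the periods against the harmonic number
  have hsum : (∑ j ∈ Finset.range K', ∫ u in (((j : ℝ) + 1) * T)..(((j : ℝ) + 1 + 1) * T), g u)
      ≤ A * ε * ((harmonic K' : ℚ) : ℝ) + 4 * (ε * C₁ / T) := by
    have hterm := Finset.sum_le_sum fun j hj => hP j (Finset.mem_range.mp hj)
    refine hterm.trans ?_
    rw [Finset.sum_add_distrib, ← Finset.mul_sum, ← Finset.mul_sum, harmonic_cast_eq_sum]
    have h4 : ∑ j ∈ Finset.range K', 4 / (((j : ℝ) + 1) * ((j : ℝ) + 1 + 1))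
        = 4 * ∑ j ∈ Finset.range K', 1 / (((j : ℝ) + 1) * ((j : ℝ) + 2)) := by
      rw [Finset.mul_sum]
      refine Finset.sum_congr rfl fun j _ => ?_
      rw [show (j : ℝ) + 1 + 1 = (j : ℝ) + 2 by ring]
      field_simp
    rw [h4]
    have hs := sum_range_inv_mul_succ_le_one K'
    have hpos' : 0 ≤ ε * C₁ / T := div_nonneg (mul_nonneg hε.le hC₁nn) hT.le
    have := mul_le_mul_of_nonneg_left hs hpos'
    linarith only [this]
  -- (iv) the tail
  have htail : |∫ u in Ioi ((K : ℝ) * T), g u| ≤ 14 * ε / ρ := by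
    rw [hg]
    refine (abs_tail_integral_le a δ ε hKT).trans ?_
    have hKT2 : ρ / (2 * ε) ≤ K * T := by
      have h : ρ / (ε * T) / 2 ≤ K := by linarith only [hKge, hx2]
      have := mul_le_mul_of_nonneg_right h hT.le
      calc ρ / (2 * ε) = ρ / (ε * T) / 2 * T := by field_simp
        _ ≤ K * T := this
    calc 7 / ((K : ℝ) * T) ≤ 7 / (ρ / (2 * ε)) :=
          div_le_div_of_nonneg_left (by norm_num) (div_pos hρ (by linarith only [hε])) hKT2
      _ = 14 * ε / ρ := by field_simp; ring
  -- (v) harmonic number against `log (1/ε)` (upper side only)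
  have hlog : ((harmonic K' : ℚ) : ℝ) ≤ 1 + Real.log (1 / ε) + |Real.log (ρ / T)| := by
    have hKK : K - 1 = K' := by omega
    obtain ⟨-, hu⟩ := log_le_harmonic_pred_le hK2
    rw [hKK] at hu
    have hKpos : (0 : ℝ) < K := by linarith only [hK2r]
    have hlogK_le : Real.log K ≤ Real.log (1 / ε) + Real.log (ρ / T) := by
      have h := Real.log_le_log hKpos hKle
      rw [Real.log_div hρ.ne' hεT.ne', Real.log_mul hε.ne' hT.ne'] at h
      rw [Real.log_div one_ne_zero hε.ne', Real.log_one, Real.log_div hρ.ne' hT.ne']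
      linarith only [h]
    have h := le_abs_self (Real.log (ρ / T))
    linarith only [hu, hlogK_le, h]
  -- (vi) assemble (`ε·C₁/T = ε·S`)
  have hC₁T : ε * C₁ / T = ε * S := by rw [hC₁]; field_simp
  have key : ∀ I₀ Sm Tl H : ℝ, |I₀| ≤ ε * S * (1 + Real.log (T * xMax a + 1)) →
      Sm ≤ A * ε * H + 4 * (ε * C₁ / T) → |Tl| ≤ 14 * ε / ρ → H ≤ 1 + Real.log (1 / ε) + |Real.log (ρ / T)| →
      Sm + I₀ + Tl ≤ A * ε * Real.log (1 / ε)
        + ε * (A * (1 + |Real.log (ρ / T)|) + S * (1 + Real.log (T * xMax a + 1)) + 4 * S + 14 / ρ) := by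
    intro I₀ Sm Tl H hI hSm hTl hH
    have hI' := (abs_le.mp hI).2
    have hTl' := (abs_le.mp hTl).2
    have hAε : 0 ≤ A * ε := mul_nonneg hA hε.le
    have hH' := mul_le_mul_of_nonneg_left hH hAε
    rw [hC₁T] at hSm
    have : A * ε * (1 + Real.log (1 / ε) + |Real.log (ρ / T)|) + 4 * (ε * S)
        + ε * S * (1 + Real.log (T * xMax a + 1)) + 14 * ε / ρ
        = A * ε * Real.log (1 / ε)
          + ε * (A * (1 + |Real.log (ρ / T)|) + S * (1 + Real.log (T * xMax a + 1)) + 4 * S + 14 / ρ) := by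
      field_simp; ring
    linarith only [hI', hSm, hTl', hH', this]
  rw [hF, hsplit, hperiods, hsumsplit]
  exact key (∫ u in (0 : ℝ)..T, g u)
    (∑ j ∈ Finset.range K', ∫ u in (((j : ℝ) + 1) * T)..(((j : ℝ) + 1 + 1) * T), g u)
    (∫ u in Ioi ((K : ℝ) * T), g u) ((harmonic K' : ℚ) : ℝ) hhead hsum htail hlog

end Summit.KontsevichZagierPeriods.Zeta5Search.Barrier.ConeGamma

end
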